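import Mathlib
import Literature.Probability.LatticeModels.SCTWardIdentity
import Literature.Probability.LatticeModels.ScalingLimit
import HarnessLib

/-!
# Stub W1 `stub_wardOfWardDir` for crux `MoebiusLimitExists` (stmt-CriticalPhenomena-1344), line `Sketch` v11
(lead prover-line-stmt-CriticalPhenomena-1344-c17-0; THEOREM-ONLY, `--supports stmt-CriticalPhenomena-1344`)

**One special conformal generator gives all, by `O(3)`.**  For ONE level `n`: if `F : (ℝ³)ⁿ → ℝ` is invariant under the
diagonal action of every linear isometry of `ℝ³` and satisfies the weak `K_{b₀}` Ward identity with weight `Δ`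
(`∫ F(x) [(2Δ−6)(Σᵢ ⟪b₀,xᵢ⟫) φ(x) + Dφ(x)[(‖xᵢ‖² b₀ − 2⟪b₀,xᵢ⟫ xᵢ)ᵢ]] dx = 0` for all smooth `φ` compactly supported off the
diagonals) for ONE parameter `b₀ ≠ 0`, then it satisfies the weak `K_b` identity for EVERY `b ∈ ℝ³`.

Proof: `b = 0` is trivial (the integrand vanishes).  For `b ≠ 0` pick a linear isometry `R` of `ℝ³` with
`R (‖b₀‖⁻¹ • b₀) = ‖b‖⁻¹ • b` (`Submodule.reflection_sub`); then `b = c • R b₀` with `c = ‖b‖/‖b₀‖`, the special conformal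
field is `O(3)`-equivariant, `K_{R b₀}(R x) = R (K_{b₀} x)` (`‖Rx‖ = ‖x‖`, `⟪R b₀, R x⟫ = ⟪b₀, x⟫`), and homogeneous,
`K_{c b} = c K_b`.  Change variables `x = R̂ y := (R yᵢ)ᵢ`: `R̂` is a measure-preserving linear homeomorphism of `(ℝ³)ⁿ`
(`MeasureTheory.measurePreserving_pi` with `LinearIsometryEquiv.measurePreserving` in each factor; `MeasureTheory.volume_pi`)
mapping `NonCoincident 3 n` onto itself, and `Dφ(R̂ y)[R̂ v] = D(φ ∘ R̂)(y)[v]`, so the `K_{R b₀}` Ward functional of `φ`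
equals the `K_{b₀}` Ward functional of the test function `φ ∘ R̂` (smooth, compactly supported, `tsupport (φ ∘ R̂) = R̂⁻¹(tsupport φ)
⊆ NonCoincident 3 n`), which vanishes by hypothesis (after `F (R̂ y) = F y`).

References: Di Francesco–Mathieu–Sénéchal, *Conformal Field Theory* (1997) §4.1 (4.18)–(4.19) (the conformal algebra:
`[L_{μν}, K_ρ]` rotates the special conformal generators). No definitions are introduced.
-/

noncomputable section

open MeasureTheory Set Function
open Literature.Probability.LatticeModels
open scoped RealInnerProductSpace

namespace Summit.CriticalPhenomena.Ising3DConformalLimit.MoebiusLimitExistsSketchV11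

variable {n : ℕ}

/-! ## Auxiliary lemmas: the special conformal field under `O(3)` and scalings -/

/-- `O(3)`-equivariance of the special conformal field `K_b(x) = ‖x‖² b − 2⟪b,x⟫ x`:
`K_{R b}(R x) = R (K_b x)` for every linear isometry `R` of `ℝ³`. [folklore] -/
theorem sct_isometry_apply (R : EuclideanSpace ℝ (Fin 3) ≃ₗᵢ[ℝ] EuclideanSpace ℝ (Fin 3))
    (b x : EuclideanSpace ℝ (Fin 3)) :
    ‖R x‖ ^ 2 • R b - (2 * inner ℝ (R b) (R x)) • R x =
      R (‖x‖ ^ 2 • b - (2 * inner ℝ b x) • x) := by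
  rw [R.norm_map, R.inner_map_map, R.map_sub, R.map_smul, R.map_smul]

/-- Homogeneity of the special conformal field in its parameter: `K_{c b} = c K_b`. [folklore] -/
theorem sct_smul_left (c : ℝ) (b x : EuclideanSpace ℝ (Fin 3)) :
    ‖x‖ ^ 2 • (c • b) - (2 * inner ℝ (c • b) x) • x = c • (‖x‖ ^ 2 • b - (2 * inner ℝ b x) • x) :=
  sctField_smul_left c b x

/-- Every vector `b ∈ ℝ³` is a scalar multiple of an isometric image of a fixed nonzero vector `b₀`:
`b = c • R b₀` with `R` the reflection exchanging the unit vectors of `b₀` and `b`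
(`Submodule.reflection_sub`) and `c = ‖b‖ / ‖b₀‖` (`c = 0`, `R = 1` if `b = 0`). [folklore] -/
theorem exists_eq_smul_isometry {b₀ : EuclideanSpace ℝ (Fin 3)} (hb₀ : b₀ ≠ 0)
    (b : EuclideanSpace ℝ (Fin 3)) :
    ∃ (c : ℝ) (R : EuclideanSpace ℝ (Fin 3) ≃ₗᵢ[ℝ] EuclideanSpace ℝ (Fin 3)), b = c • R b₀ := by
  by_cases hb : b = 0
  · exact ⟨0, LinearIsometryEquiv.refl ℝ _, by rw [hb, zero_smul]⟩
  · have hn : ‖(‖b₀‖⁻¹ • b₀ : EuclideanSpace ℝ (Fin 3))‖ =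
        ‖(‖b‖⁻¹ • b : EuclideanSpace ℝ (Fin 3))‖ := by
      rw [norm_smul, norm_smul, norm_inv, norm_inv, norm_norm, norm_norm,
        inv_mul_cancel₀ (norm_ne_zero_iff.2 hb₀), inv_mul_cancel₀ (norm_ne_zero_iff.2 hb)]
    refine ⟨‖b‖ * ‖b₀‖⁻¹, (ℝ ∙ (‖b₀‖⁻¹ • b₀ - ‖b‖⁻¹ • b))ᗮ.reflection, ?_⟩
    have hR := Submodule.reflection_sub hn
    rw [LinearIsometryEquiv.map_smul] at hR
    rw [mul_smul, hR, smul_inv_smul₀ (norm_ne_zero_iff.2 hb)]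

/-- Homogeneity of the `K`-Ward integrand in the parameter: the integrand for `c • b` is `c` times
the integrand for `b` (`⟪c b, xᵢ⟫ = c ⟪b, xᵢ⟫`, `K_{c b} = c K_b`, linearity of `Dφ(x)`). [folklore] -/
theorem ward_integrand_smul (F : (Fin n → EuclideanSpace ℝ (Fin 3)) → ℝ) (Δ c : ℝ)
    (b : EuclideanSpace ℝ (Fin 3)) (φ : (Fin n → EuclideanSpace ℝ (Fin 3)) → ℝ)
    (x : Fin n → EuclideanSpace ℝ (Fin 3)) :
    F x * ((2 * Δ - 6) * (∑ i, inner ℝ (c • b) (x i)) * φ x +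
        fderiv ℝ φ x (fun i => ‖x i‖ ^ 2 • (c • b) - (2 * inner ℝ (c • b) (x i)) • x i)) =
      c * (F x * ((2 * Δ - 6) * (∑ i, inner ℝ b (x i)) * φ x +
        fderiv ℝ φ x (fun i => ‖x i‖ ^ 2 • b - (2 * inner ℝ b (x i)) • x i))) := by
  have hK : (fun i => ‖x i‖ ^ 2 • (c • b) - (2 * inner ℝ (c • b) (x i)) • x i) =
      c • (fun i => ‖x i‖ ^ 2 • b - (2 * inner ℝ b (x i)) • x i) := by
    funext i
    simp only [Pi.smul_apply]
    exact sct_smul_left c b (x i)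
  rw [hK, map_smul]
  simp only [real_inner_smul_left, smul_eq_mul, ← Finset.mul_sum]
  ring

/-- Integrated homogeneity: `Ward_{c b}(F, φ) = c · Ward_b(F, φ)` (`MeasureTheory.integral_const_mul`,
no integrability needed). [folklore] -/
theorem ward_integral_smul (F : (Fin n → EuclideanSpace ℝ (Fin 3)) → ℝ) (Δ c : ℝ)
    (b : EuclideanSpace ℝ (Fin 3)) (φ : (Fin n → EuclideanSpace ℝ (Fin 3)) → ℝ) :
    ∫ x, F x * ((2 * Δ - 6) * (∑ i, inner ℝ (c • b) (x i)) * φ x +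
        fderiv ℝ φ x (fun i => ‖x i‖ ^ 2 • (c • b) - (2 * inner ℝ (c • b) (x i)) • x i)) =
      c * ∫ x, F x * ((2 * Δ - 6) * (∑ i, inner ℝ b (x i)) * φ x +
        fderiv ℝ φ x (fun i => ‖x i‖ ^ 2 • b - (2 * inner ℝ b (x i)) • x i)) := by
  rw [← integral_const_mul]
  exact integral_congr_ae (Filter.Eventually.of_forall fun x => ward_integrand_smul F Δ c b φ x)

/-! ## Auxiliary lemmas: the diagonal action of `O(3)` on configurations -/

/-- The diagonal action `y ↦ (R yᵢ)ᵢ` of a linear isometry `R` of `ℝ³` preserves Lebesgue measure on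
`(ℝ³)ⁿ` (`LinearIsometryEquiv.measurePreserving` in each factor, `MeasureTheory.volume_preserving_pi`).
[folklore] -/
theorem volume_preserving_isometryConfig
    (R : EuclideanSpace ℝ (Fin 3) ≃ₗᵢ[ℝ] EuclideanSpace ℝ (Fin 3)) :
    MeasurePreserving (fun (y : Fin n → EuclideanSpace ℝ (Fin 3)) (i : Fin n) => R (y i)) :=
  volume_preserving_pi fun _ : Fin n => R.measurePreserving

/-- Change of variables under the diagonal action of a linear isometry `R` of `ℝ³`:
`∫ g((R yᵢ)ᵢ) dy = ∫ g(x) dx` (both sides `0` if `g` is not integrable). [folklore] -/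
theorem integral_comp_isometryConfig
    (R : EuclideanSpace ℝ (Fin 3) ≃ₗᵢ[ℝ] EuclideanSpace ℝ (Fin 3))
    (g : (Fin n → EuclideanSpace ℝ (Fin 3)) → ℝ) :
    ∫ y : Fin n → EuclideanSpace ℝ (Fin 3), g (fun i => R (y i)) = ∫ x, g x :=
  (volume_preserving_isometryConfig R).integral_comp
    (ContinuousLinearEquiv.piCongrRight
      fun _ : Fin n => R.toContinuousLinearEquiv).toHomeomorph.measurableEmbedding g

/-- A test function pulled back along the diagonal action `R̂` of a linear isometry is again a
test function: smooth, compactly supported, and supported off the diagonals if the original is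
(`R̂` is a linear homeomorphism preserving `NonCoincident`). [folklore] -/
theorem testFunction_comp_isometryConfig
    (R : EuclideanSpace ℝ (Fin 3) ≃ₗᵢ[ℝ] EuclideanSpace ℝ (Fin 3))
    {φ : (Fin n → EuclideanSpace ℝ (Fin 3)) → ℝ}
    (hφ : ContDiff ℝ ((⊤ : ℕ∞) : WithTop ℕ∞) φ) (hφc : HasCompactSupport φ)
    (hφV : tsupport φ ⊆ NonCoincident 3 n) :
    ContDiff ℝ ((⊤ : ℕ∞) : WithTop ℕ∞)
        (φ ∘ ⇑(ContinuousLinearEquiv.piCongrRight fun _ : Fin n => R.toContinuousLinearEquiv)) ∧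
      HasCompactSupport
        (φ ∘ ⇑(ContinuousLinearEquiv.piCongrRight fun _ : Fin n => R.toContinuousLinearEquiv)) ∧
      tsupport
        (φ ∘ ⇑(ContinuousLinearEquiv.piCongrRight fun _ : Fin n => R.toContinuousLinearEquiv)) ⊆
        NonCoincident 3 n := by
  set Rc := ContinuousLinearEquiv.piCongrRight fun _ : Fin n => R.toContinuousLinearEquiv
  refine ⟨hφ.comp Rc.contDiff, hφc.comp_homeomorph Rc.toHomeomorph, ?_⟩
  refine (tsupport_comp_subset_preimage φ Rc.continuous).trans fun y hy => ?_
  have hy' : Function.Injective (⇑R ∘ y) := hφV hy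
  exact hy'.of_comp

/-- Pull-back of the `K_{R b₀}`-Ward integrand along the diagonal isometry `R̂ y = (R yᵢ)ᵢ`: it is the
`K_{b₀}`-Ward integrand of the test function `φ ∘ R̂` at `y` (using `F ∘ R̂ = F`,
`⟪R b₀, R yᵢ⟫ = ⟪b₀, yᵢ⟫`, `K_{R b₀}(R yᵢ) = R (K_{b₀} yᵢ)` and the chain rule
`Dφ(R̂ y)[R̂ v] = D(φ ∘ R̂)(y)[v]`). [folklore] -/
theorem ward_integrand_isometry (F : (Fin n → EuclideanSpace ℝ (Fin 3)) → ℝ) (Δ : ℝ)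
    (R : EuclideanSpace ℝ (Fin 3) ≃ₗᵢ[ℝ] EuclideanSpace ℝ (Fin 3))
    (hF : ∀ x : Fin n → EuclideanSpace ℝ (Fin 3), F (fun i => R (x i)) = F x)
    (b₀ : EuclideanSpace ℝ (Fin 3)) (φ : (Fin n → EuclideanSpace ℝ (Fin 3)) → ℝ)
    (y : Fin n → EuclideanSpace ℝ (Fin 3)) :
    (fun x : Fin n → EuclideanSpace ℝ (Fin 3) =>
        F x * ((2 * Δ - 6) * (∑ i, inner ℝ (R b₀) (x i)) * φ x +
          fderiv ℝ φ x (fun i => ‖x i‖ ^ 2 • R b₀ - (2 * inner ℝ (R b₀) (x i)) • x i)))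
        (fun i => R (y i)) =
      F y * ((2 * Δ - 6) * (∑ i, inner ℝ b₀ (y i)) *
          (φ ∘ ⇑(ContinuousLinearEquiv.piCongrRight
            fun _ : Fin n => R.toContinuousLinearEquiv)) y +
        fderiv ℝ (φ ∘ ⇑(ContinuousLinearEquiv.piCongrRight
            fun _ : Fin n => R.toContinuousLinearEquiv)) y
          (fun i => ‖y i‖ ^ 2 • b₀ - (2 * inner ℝ b₀ (y i)) • y i)) := by
  beta_reduce
  rw [hF, ContinuousLinearEquiv.comp_right_fderiv, ContinuousLinearMap.comp_apply,
    Function.comp_apply]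
  simp only [sct_isometry_apply]
  simp only [LinearIsometryEquiv.inner_map_map]
  rfl

/-- **One isometric image.** If `F` is invariant under the diagonal action of the linear isometry `R`
and satisfies the weak `K_{b₀}`-Ward identity, then it satisfies the weak `K_{R b₀}`-Ward identity:
change variables `x = R̂ y` (measure-preserving) and test the hypothesis with `φ ∘ R̂`. [folklore] -/
theorem ward_isometry (F : (Fin n → EuclideanSpace ℝ (Fin 3)) → ℝ) (Δ : ℝ)
    (R : EuclideanSpace ℝ (Fin 3) ≃ₗᵢ[ℝ] EuclideanSpace ℝ (Fin 3))
    (hF : ∀ x : Fin n → EuclideanSpace ℝ (Fin 3), F (fun i => R (x i)) = F x)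
    (b₀ : EuclideanSpace ℝ (Fin 3))
    (hK : ∀ (φ : (Fin n → EuclideanSpace ℝ (Fin 3)) → ℝ),
      ContDiff ℝ ((⊤ : ℕ∞) : WithTop ℕ∞) φ → HasCompactSupport φ → tsupport φ ⊆ NonCoincident 3 n →
      ∫ x, F x * ((2 * Δ - 6) * (∑ i, inner ℝ b₀ (x i)) * φ x +
        fderiv ℝ φ x (fun i => ‖x i‖ ^ 2 • b₀ - (2 * inner ℝ b₀ (x i)) • x i)) = 0)
    (φ : (Fin n → EuclideanSpace ℝ (Fin 3)) → ℝ) (hφ : ContDiff ℝ ((⊤ : ℕ∞) : WithTop ℕ∞) φ)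
    (hφc : HasCompactSupport φ) (hφV : tsupport φ ⊆ NonCoincident 3 n) :
    ∫ x, F x * ((2 * Δ - 6) * (∑ i, inner ℝ (R b₀) (x i)) * φ x +
      fderiv ℝ φ x (fun i => ‖x i‖ ^ 2 • R b₀ - (2 * inner ℝ (R b₀) (x i)) • x i)) = 0 := by
  obtain ⟨h1, h2, h3⟩ := testFunction_comp_isometryConfig R hφ hφc hφV
  -- change of variables `x = R̂ y` (the Lebesgue measure of `(ℝ³)ⁿ` is `R̂`-invariant)
  have hcv := integral_comp_isometryConfig (n := n) R
    (fun x : Fin n → EuclideanSpace ℝ (Fin 3) =>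
      F x * ((2 * Δ - 6) * (∑ i, inner ℝ (R b₀) (x i)) * φ x +
        fderiv ℝ φ x (fun i => ‖x i‖ ^ 2 • R b₀ - (2 * inner ℝ (R b₀) (x i)) • x i)))
  rw [← hcv]
  -- the pulled-back integrand is the `K_{b₀}` integrand of `φ ∘ R̂`, whose integral vanishes
  refine Eq.trans ?_ (hK _ h1 h2 h3)
  exact integral_congr_ae (Filter.Eventually.of_forall fun y =>
    ward_integrand_isometry F Δ R hF b₀ φ y)

/-! ## The stub -/

/-- **Stub W1 — `stub_wardOfWardDir`** (registered signature; see the module docstring for the proof).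
[cite: FrancescoMathieuSenechal1997, §4.1 (4.18)–(4.19)] -/
theorem stub_wardOfWardDir :
    ∀ (n : ℕ) (F : (Fin n → EuclideanSpace ℝ (Fin 3)) → ℝ) (Δ : ℝ) (b₀ : EuclideanSpace ℝ (Fin 3)), b₀ ≠ 0 →
      (∀ (R : EuclideanSpace ℝ (Fin 3) ≃ₗᵢ[ℝ] EuclideanSpace ℝ (Fin 3)) (x : Fin n → EuclideanSpace ℝ (Fin 3)),
        F (fun i => R (x i)) = F x) →
      (∀ (φ : (Fin n → EuclideanSpace ℝ (Fin 3)) → ℝ),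
        ContDiff ℝ ((⊤ : ℕ∞) : WithTop ℕ∞) φ → HasCompactSupport φ → tsupport φ ⊆ NonCoincident 3 n →
        ∫ x, F x * ((2 * Δ - 6) * (∑ i, inner ℝ b₀ (x i)) * φ x +
          fderiv ℝ φ x (fun i => ‖x i‖ ^ 2 • b₀ - (2 * inner ℝ b₀ (x i)) • x i)) = 0) →
      ∀ (b : EuclideanSpace ℝ (Fin 3)) (φ : (Fin n → EuclideanSpace ℝ (Fin 3)) → ℝ),
        ContDiff ℝ ((⊤ : ℕ∞) : WithTop ℕ∞) φ → HasCompactSupport φ → tsupport φ ⊆ NonCoincident 3 n →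
        ∫ x, F x * ((2 * Δ - 6) * (∑ i, inner ℝ b (x i)) * φ x +
          fderiv ℝ φ x (fun i => ‖x i‖ ^ 2 • b - (2 * inner ℝ b (x i)) • x i)) = 0 := by
  intro n F Δ b₀ hb₀ hO hK b φ hφ hφc hφV
  obtain ⟨c, R, rfl⟩ := exists_eq_smul_isometry hb₀ b
  rw [ward_integral_smul F Δ c (R b₀) φ, ward_isometry F Δ R (hO R) b₀ hK φ hφ hφc hφV, mul_zero]

end Summit.CriticalPhenomena.Ising3DConformalLimit.MoebiusLimitExistsSketchV11

end
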